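import Mathlib
import HarnessLib
import Summits.Ventures.LatticeQCDFlow.Scoring.IndepMHKernelPositive

/-!
# The rejection floor of the flow-MCMC kernel: `C_g(1) ≥ ∫ g²(1 − A) dπ` and
# `τ_int ≥ 1/2 + r_g/(1 − r_g)` for every bounded observable

HONEST FRAMING: exact (Metropolis-corrected) sampling algorithms for lattice gauge theory;
figures of merit are autocorrelation/cost numbers at stated couplings and volumes; no
continuum-physics claim.

Venture `LatticeQCDFlow` (cell pub-lqcd), topic `Scoring`; FANOUT row 8 (`s0-cpn-nemc`, GEN-11).
NEW WORK of the cell (one transport), not a published result: row 2's rejection floor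
`Exactness.integral_sq_mul_rejection_le` (`Exactness/FlowSamplerPositive.lean`: the held part of
`⟨g, K g⟩` is `∫ g² w r`, the accepted part is nonnegative) carried to row 30's KERNEL `indepMH q w`
through the dictionary `kop (indepMH q w) = imhOp q w 1` of `Scoring/IndepMHKernelPositive.lean`,
with the rejection probability identified as `1 − A(x).toReal`, `A = Exactness.imhAcceptMass q w`
(`Exactness/IMHKernel.lean`).  The finite-pool counterpart is row 11's `Scoring/StickingFloor.lean`
/ row 8's `Scoring/IMHWeightBlindTau.lean` (`τ_int ≥ 1/ā − 1/2` for weight-blind observables);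
here: general state space, EVERY bounded observable, weighted by `g²`.  Nothing is cited as a fact.

## What is proved (`q` a probability law, `w > 0` measurable `q`-integrable, `π = w·q` named by
## `hπ`; `g` bounded measurable; `C_g(t) = autocov (indepMH q w) π g t`, `ρ(t) = C_g(t)/C_g(0)`)

* `integral_one_sub_imhAcceptQ_one` — row 2's rejection probability with proposal density `1` is
  `1 − A(x).toReal`;
* **`indepMH_rejection_le_autocov_one`** — `∫ g² (1 − A) dπ ≤ C_g(1)` (centred or not);
* **`indepMH_tauInt_ge_rejection`** — with `r_g := ∫ g²(1 − A) dπ / ∫ g² dπ` (the `g²`-weighted mean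
  rejection probability) and a summable autocorrelation:
  `(1 + r_g)/(2(1 − r_g)) = 1/2 + r_g/(1 − r_g) ≤ τ_int(g)` (`r_g ≤ ρ(1) < 1` and the AR(1) floor of
  `Scoring/IndepMHKernelPositive.lean` is monotone).

Reading (markdown): a centred observable whose mass sits where the exact flow sampler rejects
(large `1 − A(x)`, i.e. where the model under-covers the target) has a certified large `τ_int`,
whatever the mean acceptance — the kernel-level "heavier is stickier".  NOT CLAIMED: any number of
ours; unbounded observables; a matching upper bound in terms of `r_g` (false in general).
-/

noncomputable section

namespace Summit.Ventures.LatticeQCDFlow.Scoring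

open MeasureTheory ProbabilityTheory Filter Finset Summit.Ventures.LatticeQCDFlow.Exactness
open scoped ENNReal Topology

variable {Ω : Type*} [MeasurableSpace Ω]

section Rejection

variable {q : Measure Ω} [IsProbabilityMeasure q] {w : Ω → ℝ} {π : Measure Ω}

/-- Row 2's rejection probability with proposal density `1` is the kernel's rejection mass:
`∫ (1 − imhAcceptQ w 1 x y) · 1 dq(y) = 1 − A(x).toReal`. -/
theorem integral_one_sub_imhAcceptQ_one (hw : Measurable w) (hw0 : ∀ x, 0 < w x) (x : Ω) :
    ∫ y, (1 - imhAcceptQ w (fun _ => (1 : ℝ)) x y) * 1 ∂q = 1 - (imhAcceptMass q w x).toReal := by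
  have e : ∀ y, (1 - imhAcceptQ w (fun _ => (1 : ℝ)) x y) * 1 = 1 - imhAccept w x y := fun y => by
    simp only [imhAcceptQ, imhAccept, mul_one]
  simp_rw [e]
  have hIa : Integrable (imhAccept w x) q :=
    integrable_of_bounded q (measurable_imhAccept_right hw x) (C := 1) fun y => by
      rw [abs_of_nonneg (imhAccept_nonneg hw0 x y)]; exact imhAccept_le_one w x y
  rw [integral_sub (integrable_const _) hIa, integral_const, probReal_univ, one_smul,
    toReal_imhAcceptMass hw hw0]

/-- **THE REJECTION FLOOR ON THE LAG-ONE AUTOCOVARIANCE**: for every bounded measurable `g` (centred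
or not), `∫ g² · (1 − A) dπ ≤ C_g(1)` with `A(x)` the acceptance mass from `x`. -/
theorem indepMH_rejection_le_autocov_one (hw : Measurable w) (hw0 : ∀ x, 0 < w x)
    (hwi : Integrable w q) (hπ : (q.withDensity fun x => ENNReal.ofReal (w x)) = π)
    {g : Ω → ℝ} (hg : Measurable g) {C : ℝ} (hC : ∀ x, |g x| ≤ C) :
    ∫ x, g x ^ 2 * (1 - (imhAcceptMass q w x).toReal) ∂π ≤ autocov (indepMH q w) π g 1 := by
  subst hπ
  rw [autocov_indepMH_eq hw hw0 hg hC 1, Function.iterate_one,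
    integral_withDensity_eq_integral_toReal_smul hw.ennreal_ofReal
      (ae_of_all _ fun x => ENNReal.ofReal_lt_top)]
  have h : ∫ x, g x ^ 2 * w x * (∫ y, (1 - imhAcceptQ w (fun _ => (1 : ℝ)) x y) * 1 ∂q) ∂q
      ≤ ∫ x, g x * imhOp q w (fun _ => (1 : ℝ)) g x * w x ∂q :=
    integral_sq_mul_rejection_le (μ := q) hw0 hw hwi (fun _ => one_pos) measurable_const
      (integrable_const _) (by simp) hg hC
  simp_rw [integral_one_sub_imhAcceptQ_one hw hw0] at h
  calc ∫ x, (ENNReal.ofReal (w x)).toReal • (g x ^ 2 * (1 - (imhAcceptMass q w x).toReal)) ∂q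
      = ∫ x, g x ^ 2 * w x * (1 - (imhAcceptMass q w x).toReal) ∂q := by
        refine integral_congr_ae (ae_of_all _ fun x => ?_)
        show (ENNReal.ofReal (w x)).toReal • (g x ^ 2 * (1 - (imhAcceptMass q w x).toReal)) = _
        rw [ENNReal.toReal_ofReal (hw0 x).le, smul_eq_mul]
        ring
    _ ≤ ∫ x, g x * imhOp q w (fun _ => (1 : ℝ)) g x * w x ∂q := h

/-- **`τ_int ≥ (1 + r_g)/(2(1 − r_g)) = 1/2 + r_g/(1 − r_g)`** with
`r_g = ∫ g²(1 − A) dπ / ∫ g² dπ` the `g²`-weighted mean REJECTION probability of the exact flow sampler: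
for every bounded measurable observable with a summable autocorrelation (`r_g ≤ ρ(1) < 1` and the
AR(1) floor is monotone). -/
theorem indepMH_tauInt_ge_rejection (hw : Measurable w) (hw0 : ∀ x, 0 < w x)
    (hwi : Integrable w q) (hπ : (q.withDensity fun x => ENNReal.ofReal (w x)) = π)
    {g : Ω → ℝ} (hg : Measurable g) {C : ℝ} (hC : ∀ x, |g x| ≤ C)
    (hs : Summable fun t => autocov (indepMH q w) π g (t + 1) / autocov (indepMH q w) π g 0) :
    (1 + (∫ x, g x ^ 2 * (1 - (imhAcceptMass q w x).toReal) ∂π) / autocov (indepMH q w) π g 0)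
        / (2 * (1 - (∫ x, g x ^ 2 * (1 - (imhAcceptMass q w x).toReal) ∂π)
          / autocov (indepMH q w) π g 0))
      ≤ tauInt (fun t => autocov (indepMH q w) π g t / autocov (indepMH q w) π g 0) := by
  obtain ⟨hρ1, hfloor⟩ := indepMH_tauInt_floor hw hw0 hwi hπ hg hC hs
  refine le_trans (geomTauInt_mono ?_ hρ1) hfloor
  have h0 : 0 ≤ autocov (indepMH q w) π g 0 := indepMH_autocov_nonneg hw hw0 hwi hπ hg hC 0
  rcases h0.eq_or_lt with hz | hpos
  · rw [← hz, div_zero, div_zero]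
  · exact div_le_div_of_nonneg_right (indepMH_rejection_le_autocov_one hw hw0 hwi hπ hg hC) hpos.le

end Rejection

end Summit.Ventures.LatticeQCDFlow.Scoring

end
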